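import Summits.CriticalPhenomena.CardyFormulaZ2.Theses.CardyMagicRigidity
import Literature.Probability.Percolation.CardyFormulaConformalInvariance
import Literature.Probability.RandomPlanarGeometry.ConformalRectangleProofs
import Summits.CriticalPhenomena.CardyFormulaZ2.Theorems.CardyMagicRigidityLoopsToCrossingsStubCyclicFlip
import Summits.CriticalPhenomena.CardyFormulaZ2.Theorems.CardyMagicRigidityLoopsToCrossingsStubCardyContinuity
import Summits.CriticalPhenomena.CardyFormulaZ2.Theorems.CardyMagicRigidityLoopsToCrossingsStubComparisonGeometry

/-!
# Stub D-glue of line `oracle-sandwich` (crux `LoopsToCrossings`): the comparison rectangles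

`stub_comparisonRectangles` (registered sub-goal): for every conformal rectangle `R` (uniformized by
`φ, x`) and `τ > 0` there is `m > 0` such that for every `t > 0` there are conformal rectangles
`Q`, `N` in sandwich position with room (poke-out across the right pair of arcs of `R` within `t`,
bulk `m`-inside) whose Cardy values are within `τ` of `F(η_R)`, resp. `1 - F(η_R)`.  It is the
glue `comparisonRectangles_of_stubs` of the landed stubs D1 `stub_cardyContinuity`,
D2 `stub_comparisonGeometry`, D3 `stub_cyclicFlip`.
-/

noncomputable section

namespace Summit.CriticalPhenomena.CardyFormulaZ2.Cruxes.LoopsToCrossings.OracleSandwich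

open Summit.CriticalPhenomena.CardyFormulaZ2.Theses.CardyMagicRigidity
open Literature.Probability.RandomPlanarGeometry hiding cardyFunction
open Literature.Probability.Percolation hiding cardyFunction
open Literature.Probability.LatticeModels
open Filter Topology Set MeasureTheory Metric

/-- **Glue for the re-cut stub D** (lead, sorry-free): D1, D2, D3 imply the comparison-rectangle
statement consumed by `tendsto_sub_of_stubs` (Cardy clauses from D1 applied to `R` for `Q` and to the
shifted copy `R₂` of D3 for `N`, `F(η(R₂)) = 1 - F(η(R))`). [folklore] -/
theorem comparisonRectangles_of_stubs
    (hD1 : ∀ (R : ConformalRectangle) (φ : ConformalEquiv UpperHalfPlane.upperHalfPlaneSet R.carrier)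
      (x : Fin 4 → ℝ), R.IsUniformizing φ x → ∀ τ : ℝ, 0 < τ → ∃ ε₀ : ℝ, 0 < ε₀ ∧
      ∀ (Q : ConformalRectangle), (∀ u : ℝ, dist (Q.boundary u) (R.boundary u) ≤ ε₀) →
        (∀ i : Fin 4, |Q.mark i - R.mark i| ≤ ε₀) →
        ∀ (ψ : ConformalEquiv UpperHalfPlane.upperHalfPlaneSet Q.carrier) (y : Fin 4 → ℝ),
          Q.IsUniformizing ψ y →
          |Literature.Probability.RandomPlanarGeometry.cardyFunction (crossRatio y) -
            Literature.Probability.RandomPlanarGeometry.cardyFunction (crossRatio x)| ≤ τ)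
    (hD2 : ∀ (R : ConformalRectangle) (ε₀ : ℝ), 0 < ε₀ → ∃ m : ℝ, 0 < m ∧ ∀ t : ℝ, 0 < t →
      (∃ (Q : ConformalRectangle) (r : ℝ), 0 < r ∧
          (∀ u : ℝ, dist (Q.boundary u) (R.boundary u) ≤ ε₀) ∧
          (∀ i : Fin 4, |Q.mark i - R.mark i| ≤ ε₀) ∧
          (∀ z ∈ cthickening r Q.carrier, z ∉ R.carrier →
            infDist z (R.arc 0) ≤ t ∨ infDist z (R.arc 2) ≤ t) ∧
          (∀ z ∈ cthickening r Q.carrier, z ∈ R.carrier →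
            m ≤ infDist z (R.arc 1) ∧ m ≤ infDist z (R.arc 3)) ∧
          (∀ z ∈ cthickening r (Q.arc 0), z ∉ R.carrier ∧ infDist z (R.arc 0) ≤ t) ∧
          (∀ z ∈ cthickening r (Q.arc 2), z ∉ R.carrier ∧ infDist z (R.arc 2) ≤ t)) ∧
      (∃ (N : ConformalRectangle) (r : ℝ), 0 < r ∧
          (∀ u : ℝ, dist (N.boundary u) (R.boundary (u + R.mark 1)) ≤ ε₀) ∧
          (∀ i : Fin 4, |N.mark i -
            ![0, R.mark 2 - R.mark 1, R.mark 3 - R.mark 1, R.mark 0 + 1 - R.mark 1] i| ≤ ε₀) ∧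
          (∀ z ∈ cthickening r N.carrier, z ∉ R.carrier →
            infDist z (R.arc 1) ≤ t ∨ infDist z (R.arc 3) ≤ t) ∧
          (∀ z ∈ cthickening r N.carrier, z ∈ R.carrier →
            m ≤ infDist z (R.arc 0) ∧ m ≤ infDist z (R.arc 2)) ∧
          (∀ z ∈ cthickening r N.carrier, z ∈ R.carrier → ∀ j : Fin 4, m ≤ dist z (R.pt j)) ∧
          (∀ z ∈ cthickening r (N.arc 0), z ∉ R.carrier ∧ infDist z (R.arc 1) ≤ t) ∧
          (∀ z ∈ cthickening r (N.arc 2), z ∉ R.carrier ∧ infDist z (R.arc 3) ≤ t)))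
    (hD3 : ∀ R : ConformalRectangle, ∃ R₂ : ConformalRectangle, R₂.carrier = R.carrier ∧
      (∀ u : ℝ, R₂.boundary u = R.boundary (u + R.mark 1)) ∧
      (∀ i : Fin 4, R₂.mark i = ![0, R.mark 2 - R.mark 1, R.mark 3 - R.mark 1, R.mark 0 + 1 - R.mark 1] i) ∧
      ∀ (φ : ConformalEquiv UpperHalfPlane.upperHalfPlaneSet R.carrier) (x : Fin 4 → ℝ)
        (φ₂ : ConformalEquiv UpperHalfPlane.upperHalfPlaneSet R₂.carrier) (x₂ : Fin 4 → ℝ),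
        R.IsUniformizing φ x → R₂.IsUniformizing φ₂ x₂ →
        Literature.Probability.RandomPlanarGeometry.cardyFunction (crossRatio x₂) =
          1 - Literature.Probability.RandomPlanarGeometry.cardyFunction (crossRatio x)) :
    ∀ (R : ConformalRectangle) (φ : ConformalEquiv UpperHalfPlane.upperHalfPlaneSet R.carrier)
      (x : Fin 4 → ℝ), R.IsUniformizing φ x → ∀ τ : ℝ, 0 < τ →
      ∃ m : ℝ, 0 < m ∧ ∀ t : ℝ, 0 < t →
        (∃ (Q : ConformalRectangle) (ψ : ConformalEquiv UpperHalfPlane.upperHalfPlaneSet Q.carrier)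
            (y : Fin 4 → ℝ) (r : ℝ), Q.IsUniformizing ψ y ∧ 0 < r ∧
            |Literature.Probability.RandomPlanarGeometry.cardyFunction (crossRatio y) - Literature.Probability.RandomPlanarGeometry.cardyFunction (crossRatio x)| ≤ τ ∧
            (∀ z ∈ cthickening r Q.carrier, z ∉ R.carrier →
              infDist z (R.arc 0) ≤ t ∨ infDist z (R.arc 2) ≤ t) ∧
            (∀ z ∈ cthickening r Q.carrier, z ∈ R.carrier →
              m ≤ infDist z (R.arc 1) ∧ m ≤ infDist z (R.arc 3)) ∧
            (∀ z ∈ cthickening r (Q.arc 0), z ∉ R.carrier ∧ infDist z (R.arc 0) ≤ t) ∧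
            (∀ z ∈ cthickening r (Q.arc 2), z ∉ R.carrier ∧ infDist z (R.arc 2) ≤ t)) ∧
        (∃ (N : ConformalRectangle) (ψ : ConformalEquiv UpperHalfPlane.upperHalfPlaneSet N.carrier)
            (y : Fin 4 → ℝ) (r : ℝ), N.IsUniformizing ψ y ∧ 0 < r ∧
            |Literature.Probability.RandomPlanarGeometry.cardyFunction (crossRatio y) - (1 - Literature.Probability.RandomPlanarGeometry.cardyFunction (crossRatio x))| ≤ τ ∧
            (∀ z ∈ cthickening r N.carrier, z ∉ R.carrier →
              infDist z (R.arc 1) ≤ t ∨ infDist z (R.arc 3) ≤ t) ∧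
            (∀ z ∈ cthickening r N.carrier, z ∈ R.carrier →
              m ≤ infDist z (R.arc 0) ∧ m ≤ infDist z (R.arc 2)) ∧
            (∀ z ∈ cthickening r N.carrier, z ∈ R.carrier → ∀ j : Fin 4, m ≤ dist z (R.pt j)) ∧
            (∀ z ∈ cthickening r (N.arc 0), z ∉ R.carrier ∧ infDist z (R.arc 1) ≤ t) ∧
            (∀ z ∈ cthickening r (N.arc 2), z ∉ R.carrier ∧ infDist z (R.arc 3) ≤ t)) := by
  intro R φ x hux τ hτ
  obtain ⟨R₂, _hcar, hbd, hmk, hflip⟩ := hD3 R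
  obtain ⟨φ₂, x₂, hux₂⟩ := MarkedDomain.exists_isUniformizing_holds R₂
  obtain ⟨ε₁, hε₁, h1⟩ := hD1 R φ x hux τ hτ
  obtain ⟨ε₂, hε₂, h2⟩ := hD1 R₂ φ₂ x₂ hux₂ τ hτ
  obtain ⟨m, hm, hgeo⟩ := hD2 R (min ε₁ ε₂) (lt_min hε₁ hε₂)
  refine ⟨m, hm, fun t ht => ?_⟩
  obtain ⟨⟨Q, r, hr, hQb, hQm, L1, L2, L3, L4⟩, ⟨N, r', hr', hNb, hNm, U1, U2, U3, U4, U5⟩⟩ :=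
    hgeo t ht
  constructor
  · obtain ⟨ψ, y, huy⟩ := MarkedDomain.exists_isUniformizing_holds Q
    refine ⟨Q, ψ, y, r, huy, hr, ?_, L1, L2, L3, L4⟩
    exact h1 Q (fun u => (hQb u).trans (min_le_left _ _))
      (fun i => (hQm i).trans (min_le_left _ _)) ψ y huy
  · obtain ⟨ψ, y, huy⟩ := MarkedDomain.exists_isUniformizing_holds N
    refine ⟨N, ψ, y, r', huy, hr', ?_, U1, U2, U3, U4, U5⟩
    have key := h2 N (fun u => by rw [hbd u]; exact (hNb u).trans (min_le_right _ _))
      (fun i => by rw [hmk i]; exact (hNm i).trans (min_le_right _ _)) ψ y huy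
    rwa [hflip φ x φ₂ x₂ hux hux₂] at key

/-- **Stub D-glue** (registered sub-goal `stub_comparisonRectangles`): the comparison rectangles
of `R`, from D1, D2, D3. [folklore] -/
theorem stub_comparisonRectangles :
    ∀ (R : ConformalRectangle) (φ : ConformalEquiv UpperHalfPlane.upperHalfPlaneSet R.carrier)
      (x : Fin 4 → ℝ), R.IsUniformizing φ x → ∀ τ : ℝ, 0 < τ →
      ∃ m : ℝ, 0 < m ∧ ∀ t : ℝ, 0 < t →
        (∃ (Q : ConformalRectangle) (ψ : ConformalEquiv UpperHalfPlane.upperHalfPlaneSet Q.carrier)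
            (y : Fin 4 → ℝ) (r : ℝ), Q.IsUniformizing ψ y ∧ 0 < r ∧
            |Literature.Probability.RandomPlanarGeometry.cardyFunction (crossRatio y) - Literature.Probability.RandomPlanarGeometry.cardyFunction (crossRatio x)| ≤ τ ∧
            (∀ z ∈ cthickening r Q.carrier, z ∉ R.carrier →
              infDist z (R.arc 0) ≤ t ∨ infDist z (R.arc 2) ≤ t) ∧
            (∀ z ∈ cthickening r Q.carrier, z ∈ R.carrier →
              m ≤ infDist z (R.arc 1) ∧ m ≤ infDist z (R.arc 3)) ∧
            (∀ z ∈ cthickening r (Q.arc 0), z ∉ R.carrier ∧ infDist z (R.arc 0) ≤ t) ∧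
            (∀ z ∈ cthickening r (Q.arc 2), z ∉ R.carrier ∧ infDist z (R.arc 2) ≤ t)) ∧
        (∃ (N : ConformalRectangle) (ψ : ConformalEquiv UpperHalfPlane.upperHalfPlaneSet N.carrier)
            (y : Fin 4 → ℝ) (r : ℝ), N.IsUniformizing ψ y ∧ 0 < r ∧
            |Literature.Probability.RandomPlanarGeometry.cardyFunction (crossRatio y) - (1 - Literature.Probability.RandomPlanarGeometry.cardyFunction (crossRatio x))| ≤ τ ∧
            (∀ z ∈ cthickening r N.carrier, z ∉ R.carrier →
              infDist z (R.arc 1) ≤ t ∨ infDist z (R.arc 3) ≤ t) ∧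
            (∀ z ∈ cthickening r N.carrier, z ∈ R.carrier →
              m ≤ infDist z (R.arc 0) ∧ m ≤ infDist z (R.arc 2)) ∧
            (∀ z ∈ cthickening r N.carrier, z ∈ R.carrier → ∀ j : Fin 4, m ≤ dist z (R.pt j)) ∧
            (∀ z ∈ cthickening r (N.arc 0), z ∉ R.carrier ∧ infDist z (R.arc 1) ≤ t) ∧
            (∀ z ∈ cthickening r (N.arc 2), z ∉ R.carrier ∧ infDist z (R.arc 3) ≤ t)) :=
  comparisonRectangles_of_stubs stub_cardyContinuity stub_comparisonGeometry stub_cyclicFlip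

end Summit.CriticalPhenomena.CardyFormulaZ2.Cruxes.LoopsToCrossings.OracleSandwich

end
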